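import Mathlib
import Summits.NavierStokesRegularity.NavierStokesRegularity.Theorems.SubOnsagerCeilingKPStarvedNetworkBarrier
import Summits.NavierStokesRegularity.NavierStokesRegularity.Theorems.OrthantWakeOrthantTableStructure
import HarnessLib

/-!
# STARVED NETWORKS, GENERAL FORM — subsumption of the landed class-wide corners and a NEW witness (pumps AND leaks into one pocket)
# (helper file for the crux `SubOnsagerCeiling.ForwardTailCeilingKP`, stmt-NavierStokesRegularity-27057, `--supports`)

Companion of `Theorems/SubOnsagerCeilingKPStarvedNetwork{Starvation,Flux,Barrier}.lean`.

* `sharedPocket_gramDomination` — the hypotheses of the landed class-wide PUMP form (`sharedPocket_shellBarrierAt`: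
  live `0,1,2`, pocket `3` fed by pumps `P a`, `ρ·w_{ae} ≤ P a`, `κ·Σ_e w_{ae} ≤ P a`) imply GRAM DOMINATION with `Q = {3}`, `r = ρκ`,
  so that corner is an instance of `starvedNetwork_shellBarrierAt` (formal subsumption certificate);
* `leakPocket_gramDomination` — the same for the landed class-wide LEAK form (`leakPocket_shellBarrierAt`: no in-shell
  coupling, `ρ·w_{ae} ≤ W_a` for live `e`, `κ·(w_{a0}+w_{a1}+w_{a2}) ≤ W_a`);
* `mixedPocket_nonempty_shellBarrierAt` — a NEW architecture inside the crux's hypotheses (`E₂(4)`, orthant, diagonal feeds) covered by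
  the general theorem and by none of the earlier corners: the uniform KP 3-cycle `0 → 1 → 2 → 0` (weights `1/2`) whose pocket `3` is fed
  by in-shell PUMPS from `0` and `2` (weights `1`) AND by a forward LEAK from `1` (weight `1`) — pumps and leaks into one pocket at once
  (item R6 of leafhand-2's remaining list); Gram margin `r = 4 > ε₀` at EVERY `ε₀ ∈ (0, 1]`.

HONEST FRAMING: MODEL lattice algebra (route SubOnsagerCeiling, rung TL-M2Break); corners of the registered stubs, not the stubs; no crux or
summit is proved and nothing here bears on Navier–Stokes regularity. [cite: Tao2016AveragedNS, §4 (4.2)–(4.3), (4.13)]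
-/

noncomputable section

-- the sub-problem namespace `NavierStokesRegularity.NavierStokesRegularity` is the tree's layout (D-0017)
set_option linter.dupNamespace false

namespace Summit.NavierStokesRegularity.NavierStokesRegularity.Theorems

open Finset
open Literature.Analysis.FluidPDE.TaoCascade
open Summit.NavierStokesRegularity.NavierStokesRegularity.Theorems.SubOnsagerCeiling

/-! ## Subsumption of the two landed class-wide forms -/

/-- The complement of the pocket `{3}` is the live set `{0,1,2}`. [this file] -/
theorem starved_compl_three : (({3} : Finset (Fin 4))ᶜ) = {0, 1, 2} := by decide

/-- **The shared-pocket (pump) corner is an instance of the general starvation theorem**: the strength hypotheses of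
`sharedPocket_shellBarrierAt` (`ρ·w_{ae} ≤ P a`, `κ·Σ_e w_{ae} ≤ P a`, pumps `P a` into the pocket `3`, `P 3 = 0`) imply GRAM DOMINATION
with `Q = {3}`, pump matrix `α a a d (0,0,0)` and margin `r = ρκ` — so `starvedNetwork_shellBarrierAt` applies verbatim (with
`hPump := fun _ _ => rfl`). MODEL lattice algebra. [cite: Tao2016AveragedNS, §4 (4.2)–(4.3)] -/
theorem sharedPocket_gramDomination {α : Fin 4 → Fin 4 → Fin 4 → ℤ × ℤ × ℤ → ℝ} {P : Fin 4 → ℝ} {ρ κ : ℝ}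
    (hc : IsCancellingCoeff α)
    (hO : ∀ (Y : Fin 4 → ℤ → ℝ → ℝ) (τ : ℝ), (∀ (j : Fin 4) (k : ℤ), 1 ≤ k → 0 ≤ Y j k τ) →
      ∀ δ : ℝ, 0 < δ → ∀ (i : Fin 4) (n : ℤ), 1 ≤ n → Y i n τ = 0 → 0 ≤ quadTerm δ α Y i n τ)
    (hρ0 : 0 ≤ ρ) (hκ0 : 0 ≤ κ) (hPnn : ∀ a, 0 ≤ P a)
    (hρ : ∀ a e : Fin 4, ρ * α a a e (0, 0, 1) ≤ P a) (hκ : ∀ a : Fin 4, κ * ∑ e, α a a e (0, 0, 1) ≤ P a)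
    (hPump : ∀ a d : Fin 4, a ≠ d → α a a d (0, 0, 0) = if d = 3 then P a else 0) (hP33 : P 3 = 0) :
    (∀ a d : Fin 4, 0 ≤ α a a d (0, 0, 0)) ∧ (∀ d ∈ ({3} : Finset (Fin 4)), ∀ j : Fin 4, α d d j (0, 0, 0) = 0) ∧
      (∀ a j : Fin 4, j ∉ ({3} : Finset (Fin 4)) → α a a j (0, 0, 0) = 0) ∧
      ∀ a c : Fin 4, a ∉ ({3} : Finset (Fin 4)) → c ∉ ({3} : Finset (Fin 4)) →
        ρ * κ * ∑ e ∈ ({3} : Finset (Fin 4))ᶜ, α a a e (0, 0, 1) * α c c e (0, 0, 1) ≤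
          ∑ d ∈ ({3} : Finset (Fin 4)), (α a a d (0, 0, 0) * α c c d (0, 0, 0) + α a a d (0, 0, 1) * α c c d (0, 0, 1)) := by
  have hw0 : ∀ c i : Fin 4, 0 ≤ α c c i (0, 0, 1) := fun c i => kpProper_feed_nonneg hO c i
  have hdiag : ∀ a : Fin 4, α a a a (0, 0, 0) = 0 := fun a => kpProper_inShell_diag_zero hc a
  -- the pump matrix read off the table
  have hP' : ∀ a d : Fin 4, α a a d (0, 0, 0) = if a ≠ d ∧ d = 3 then P a else 0 := by
    intro a d
    by_cases had : a = d
    · subst had; simp [hdiag]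
    · rw [hPump a d had]; simp [had]
  refine ⟨?_, ?_, ?_, ?_⟩
  · intro a d; rw [hP' a d]; split_ifs <;> simp [hPnn]
  · intro d hd j; rw [Finset.mem_singleton] at hd; subst hd
    rw [hP']; simp [hP33]
  · intro a j hj; rw [Finset.mem_singleton] at hj; rw [hP']; simp [hj]
  intro a c ha hc'
  rw [Finset.mem_singleton] at ha hc'
  rw [Finset.sum_singleton, hP' a 3, hP' c 3]
  simp only [ha, hc', ne_eq, not_false_eq_true, and_self, if_true]
  -- `ρκ Σ_{e≠3} w_ae w_ce ≤ κ Σ_e (ρ w_ae) w_ce ≤ κ Σ_e P_a w_ce = P_a (κ Σ_e w_ce) ≤ P_a P_c`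
  have h1 : ∑ e ∈ ({3} : Finset (Fin 4))ᶜ, α a a e (0, 0, 1) * α c c e (0, 0, 1) ≤
      ∑ e, α a a e (0, 0, 1) * α c c e (0, 0, 1) :=
    Finset.sum_le_sum_of_subset_of_nonneg (Finset.subset_univ _) fun e _ _ => mul_nonneg (hw0 a e) (hw0 c e)
  have h2 : ρ * ∑ e, α a a e (0, 0, 1) * α c c e (0, 0, 1) ≤ P a * ∑ e, α c c e (0, 0, 1) := by
    rw [Finset.mul_sum, Finset.mul_sum]
    refine Finset.sum_le_sum fun e _ => ?_
    have := mul_le_mul_of_nonneg_right (hρ a e) (hw0 c e)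
    linarith [this]
  have h3 : κ * ∑ e, α c c e (0, 0, 1) ≤ P c := hκ c
  have h4 : 0 ≤ α a a 3 (0, 0, 1) * α c c 3 (0, 0, 1) := mul_nonneg (hw0 a 3) (hw0 c 3)
  have h5 : ρ * κ * ∑ e ∈ ({3} : Finset (Fin 4))ᶜ, α a a e (0, 0, 1) * α c c e (0, 0, 1) ≤
      ρ * κ * ∑ e, α a a e (0, 0, 1) * α c c e (0, 0, 1) :=
    mul_le_mul_of_nonneg_left h1 (mul_nonneg hρ0 hκ0)
  have h6 : ρ * κ * ∑ e, α a a e (0, 0, 1) * α c c e (0, 0, 1) ≤ κ * (P a * ∑ e, α c c e (0, 0, 1)) := by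
    have := mul_le_mul_of_nonneg_left h2 hκ0
    linarith [this]
  have h7 : κ * (P a * ∑ e, α c c e (0, 0, 1)) ≤ P a * P c := by
    have := mul_le_mul_of_nonneg_left h3 (hPnn a)
    linarith [this]
  linarith

/-- **The leak-pocket corner is an instance of the general starvation theorem**: the strength hypotheses of
`leakPocket_shellBarrierAt` (`ρ·w_{ae} ≤ W_a` for live `e`, `κ·(w_{a0}+w_{a1}+w_{a2}) ≤ W_a`, `W_a = w_{a3}`) imply GRAM DOMINATION with
`Q = {3}`, zero pump matrix and margin `r = ρκ` — so `starvedNetwork_shellBarrierAt` applies verbatim. MODEL lattice algebra.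
[cite: Tao2016AveragedNS, §4 (4.2)–(4.3)] -/
theorem leakPocket_gramDomination {α : Fin 4 → Fin 4 → Fin 4 → ℤ × ℤ × ℤ → ℝ} {ρ κ : ℝ}
    (hO : ∀ (Y : Fin 4 → ℤ → ℝ → ℝ) (τ : ℝ), (∀ (j : Fin 4) (k : ℤ), 1 ≤ k → 0 ≤ Y j k τ) →
      ∀ δ : ℝ, 0 < δ → ∀ (i : Fin 4) (n : ℤ), 1 ≤ n → Y i n τ = 0 → 0 ≤ quadTerm δ α Y i n τ)
    (hκ0 : 0 ≤ κ) (hρ : ∀ a e : Fin 4, e ≠ 3 → ρ * α a a e (0, 0, 1) ≤ α a a 3 (0, 0, 1))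
    (hκ : ∀ a : Fin 4, κ * (α a a 0 (0, 0, 1) + α a a 1 (0, 0, 1) + α a a 2 (0, 0, 1)) ≤ α a a 3 (0, 0, 1)) :
    ∀ a c : Fin 4, a ∉ ({3} : Finset (Fin 4)) → c ∉ ({3} : Finset (Fin 4)) →
      ρ * κ * ∑ e ∈ ({3} : Finset (Fin 4))ᶜ, α a a e (0, 0, 1) * α c c e (0, 0, 1) ≤
        ∑ d ∈ ({3} : Finset (Fin 4)), ((fun _ _ => (0 : ℝ)) a d * (fun _ _ => (0 : ℝ)) c d +
          α a a d (0, 0, 1) * α c c d (0, 0, 1)) := by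
  have hw0 : ∀ c i : Fin 4, 0 ≤ α c c i (0, 0, 1) := fun c i => kpProper_feed_nonneg hO c i
  intro a c _ _
  rw [Finset.sum_singleton, starved_compl_three, Finset.sum_insert (by decide), Finset.sum_insert (by decide),
    Finset.sum_singleton]
  simp only [zero_mul, zero_add]
  -- `ρκ Σ_{e<3} w_ae w_ce ≤ κ Σ_{e<3} W_a w_ce = W_a κ (w_c0+w_c1+w_c2) ≤ W_a W_c`
  have e0 := mul_le_mul_of_nonneg_right (hρ a 0 (by decide)) (hw0 c 0)
  have e1 := mul_le_mul_of_nonneg_right (hρ a 1 (by decide)) (hw0 c 1)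
  have e2 := mul_le_mul_of_nonneg_right (hρ a 2 (by decide)) (hw0 c 2)
  have h2 : ρ * (α a a 0 (0, 0, 1) * α c c 0 (0, 0, 1) + (α a a 1 (0, 0, 1) * α c c 1 (0, 0, 1) +
      α a a 2 (0, 0, 1) * α c c 2 (0, 0, 1))) ≤
      α a a 3 (0, 0, 1) * (α c c 0 (0, 0, 1) + α c c 1 (0, 0, 1) + α c c 2 (0, 0, 1)) := by
    nlinarith [e0, e1, e2]
  have h3 := mul_le_mul_of_nonneg_left (hκ c) (hw0 a 3)
  have h4 := mul_le_mul_of_nonneg_left h2 hκ0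
  nlinarith [h3, h4, hw0 a 3, hw0 c 3]

/-! ## A new witness: the 3-cycle whose pocket is fed by pumps AND a leak -/

section MixedPocket

variable {α : Fin 4 → Fin 4 → Fin 4 → ℤ × ℤ × ℤ → ℝ}
  (hfeed : ∀ i₁ i₂ i₃ : Fin 4, α i₁ i₂ i₃ ((0 : ℤ), (0 : ℤ), (1 : ℤ)) =
      (if i₁ = i₂ ∧ ((i₁ = 0 ∧ i₃ = 1) ∨ (i₁ = 1 ∧ i₃ = 2) ∨ (i₁ = 2 ∧ i₃ = 0)) then (1 / 2 : ℝ) else 0) +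
        (if i₁ = i₂ ∧ i₁ = 1 ∧ i₃ = 3 then (1 : ℝ) else 0))
  (hup1 : ∀ i₁ i₂ i₃ : Fin 4, α i₁ i₂ i₃ ((1 : ℤ), (0 : ℤ), (0 : ℤ)) =
      (if i₂ = i₃ ∧ ((i₂ = 0 ∧ i₁ = 1) ∨ (i₂ = 1 ∧ i₁ = 2) ∨ (i₂ = 2 ∧ i₁ = 0)) then (-(1 / 4) : ℝ) else 0) +
        (if i₂ = i₃ ∧ i₂ = 1 ∧ i₁ = 3 then (-(1 / 2) : ℝ) else 0))
  (hup2 : ∀ i₁ i₂ i₃ : Fin 4, α i₁ i₂ i₃ ((0 : ℤ), (1 : ℤ), (0 : ℤ)) =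
      (if i₁ = i₃ ∧ ((i₁ = 0 ∧ i₂ = 1) ∨ (i₁ = 1 ∧ i₂ = 2) ∨ (i₁ = 2 ∧ i₂ = 0)) then (-(1 / 4) : ℝ) else 0) +
        (if i₁ = i₃ ∧ i₁ = 1 ∧ i₂ = 3 then (-(1 / 2) : ℝ) else 0))
  (hin : ∀ i₁ i₂ i₃ : Fin 4, α i₁ i₂ i₃ ((0 : ℤ), (0 : ℤ), (0 : ℤ)) =
      (if i₁ = i₂ ∧ (i₁ = 0 ∨ i₁ = 2) ∧ i₃ = 3 then (1 : ℝ) else 0) + (if i₂ = 3 ∧ i₃ = i₁ ∧ (i₁ = 0 ∨ i₁ = 2) then -(1 / 2) else 0) +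
        (if i₁ = 3 ∧ i₃ = i₂ ∧ (i₂ = 0 ∨ i₂ = 2) then -(1 / 2) else 0))
include hfeed hup1 hup2 hin

/-- Symmetry (4.2) and cancellation (4.3) of the mixed-pocket table. [this file] -/
theorem mixedPocket_symmCanc : (IsSymmetricCoeff α ∧ IsCancellingCoeff α) ∧ α 1 1 3 (0, 0, 1) = 1 := by
  refine ⟨⟨?_, ?_⟩, by rw [hfeed]; simp⟩
  · intro i₁ i₂ i₃ μ₁ μ₂ μ₃ hμ
    rw [mem_shiftSet_iff] at hμ
    simp only [Prod.mk.injEq] at hμ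
    rcases hμ with ⟨rfl, rfl, rfl⟩ | ⟨rfl, rfl, rfl⟩ | ⟨rfl, rfl, rfl⟩ | ⟨rfl, rfl, rfl⟩
    · simp only [hin]
      fin_cases i₁ <;> fin_cases i₂ <;> fin_cases i₃ <;> simp
    · simp only [hup1, hup2]
    · simp only [hup1, hup2]
    · simp only [hfeed]
      fin_cases i₁ <;> fin_cases i₂ <;> fin_cases i₃ <;> simp
  · intro i₁ i₂ i₃ μ₁ μ₂ μ₃ hμ
    rw [mem_shiftSet_iff] at hμ
    simp only [Prod.mk.injEq] at hμ
    rcases hμ with ⟨rfl, rfl, rfl⟩ | ⟨rfl, rfl, rfl⟩ | ⟨rfl, rfl, rfl⟩ | ⟨rfl, rfl, rfl⟩ <;>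
      simp only [hin, hfeed, hup1, hup2] <;>
      fin_cases i₁ <;> fin_cases i₂ <;> fin_cases i₃ <;> simp <;> norm_num

/-- `4`-comparability of the mixed-pocket table. [this file] -/
theorem mixedPocket_comparable : IsComparableCoeff 4 α ∧ α 1 1 3 (0, 0, 1) = 1 := by
  refine ⟨?_, by rw [hfeed]; simp⟩
  intro i₁ i₂ i₃ μ hμ
  rw [mem_shiftSet_iff] at hμ
  rcases hμ with rfl | rfl | rfl | rfl <;>
    simp only [hin, hfeed, hup1, hup2] <;>
    fin_cases i₁ <;> fin_cases i₂ <;> fin_cases i₃ <;> simp <;> norm_num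

/-- The orthant (Kamke) hypothesis of the crux for the mixed-pocket table, via `orthant_iff_coefficients`. [this file] -/
theorem mixedPocket_orthant :
    (∀ (Y : Fin 4 → ℤ → ℝ → ℝ) (τ : ℝ), (∀ (j : Fin 4) (k : ℤ), 1 ≤ k → 0 ≤ Y j k τ) →
      ∀ δ : ℝ, 0 < δ → ∀ (i : Fin 4) (n : ℤ), 1 ≤ n → Y i n τ = 0 → 0 ≤ quadTerm δ α Y i n τ) ∧ α 1 1 3 (0, 0, 1) = 1 := by
  refine ⟨?_, by rw [hfeed]; simp⟩
  rw [orthant_iff_coefficients]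
  refine ⟨?_, ?_, ?_⟩
  · intro i y
    simp only [hfeed, Fin.sum_univ_four]
    fin_cases i
    · simp
      exact mul_self_nonneg _
    · simp
      exact mul_self_nonneg _
    · simp
      exact mul_self_nonneg _
    · simp
      exact mul_self_nonneg _
  · intro i a b hbi
    simp only [hup1, hup2]
    fin_cases i <;> fin_cases a <;> fin_cases b <;> simp at hbi ⊢
  · intro i y hy hyi
    simp only [hin, Fin.sum_univ_four]
    fin_cases i
    · have h0 : y 0 = 0 := hyi
      simp [h0]
    · have h1 : y 1 = 0 := hyi
      simp [h1]
    · have h2 : y 2 = 0 := hyi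
      simp [h2]
    · simp
      nlinarith [mul_self_nonneg (y 0), mul_self_nonneg (y 2)]

omit hup1 hup2 in
/-- The starved-class hypotheses of the mixed-pocket table (`Q = {3}`, pump matrix read off the table, Gram margin `r = 4`). [this file] -/
theorem mixedPocket_classHyps :
    (∀ a b i : Fin 4, a ≠ b → α a b i (0, 0, 1) = 0) ∧
      (∀ a d : Fin 4, 0 ≤ α a a d (0, 0, 0)) ∧
      (∀ a b d : Fin 4, a ≠ b → a ≠ d → b ≠ d → α a b d (0, 0, 0) = 0) ∧
      (∀ d ∈ ({3} : Finset (Fin 4)), ∀ e : Fin 4, α d d e (0, 0, 1) = 0) ∧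
      (∀ d ∈ ({3} : Finset (Fin 4)), ∀ j : Fin 4, α d d j (0, 0, 0) = 0) ∧
      (∀ a j : Fin 4, j ∉ ({3} : Finset (Fin 4)) → α a a j (0, 0, 0) = 0) ∧
      (∀ a c : Fin 4, a ∉ ({3} : Finset (Fin 4)) → c ∉ ({3} : Finset (Fin 4)) →
        (4 : ℝ) * ∑ e ∈ ({3} : Finset (Fin 4))ᶜ, α a a e (0, 0, 1) * α c c e (0, 0, 1) ≤
          ∑ d ∈ ({3} : Finset (Fin 4)), (α a a d (0, 0, 0) * α c c d (0, 0, 0) + α a a d (0, 0, 1) * α c c d (0, 0, 1))) ∧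
      (∀ a : Fin 4, a ≠ 3 → ∃ e : Fin 4, e ≠ 3 ∧ α a a e (0, 0, 1) ≠ 0) ∧
      α 1 1 3 (0, 0, 1) ≠ 0 ∧ α 0 0 3 (0, 0, 0) ≠ 0 := by
  refine ⟨?_, ?_, ?_, ?_, ?_, ?_, ?_, ?_, ?_, ?_⟩
  · intro a b i hab
    rw [hfeed]
    simp [hab]
  · intro a d
    rw [hin]
    fin_cases a <;> fin_cases d <;> simp
  · intro a b d hab had hbd
    rw [hin]
    fin_cases a <;> fin_cases b <;> fin_cases d <;> simp at hab had hbd ⊢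
  · intro d hd e
    rw [Finset.mem_singleton] at hd
    subst hd
    rw [hfeed]
    fin_cases e <;> simp
  · intro d hd j
    rw [Finset.mem_singleton] at hd
    subst hd
    rw [hin]
    fin_cases j <;> simp
  · intro a j hj
    rw [Finset.mem_singleton] at hj
    rw [hin]
    fin_cases a <;> fin_cases j <;> simp at hj ⊢
  · intro a c ha hc
    rw [Finset.mem_singleton] at ha hc
    rw [Finset.sum_singleton, starved_compl_three, Finset.sum_insert (by decide), Finset.sum_insert (by decide),
      Finset.sum_singleton]
    simp only [hfeed, hin]
    fin_cases a <;> fin_cases c <;> simp at ha hc ⊢ <;> norm_num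
  · intro a ha
    fin_cases a
    · exact ⟨1, by decide, by rw [hfeed]; simp⟩
    · exact ⟨2, by decide, by rw [hfeed]; simp⟩
    · exact ⟨0, by decide, by rw [hfeed]; simp⟩
    · exact absurd rfl ha
  · rw [hfeed]; simp
  · rw [hin]; simp

end MixedPocket

/-- **THE UNIFORM 3-CYCLE WHOSE POCKET IS FED BY PUMPS AND A LEAK obeys the ν-uniform shell barrier at EVERY scale ratio**: there is a
table of `E₂(4)`, orthant, with diagonal feeds, whose live modes `0,1,2` form the KP 3-cycle `0 → 1 → 2 → 0` (weights `1/2`), whose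
pocket `3` receives in-shell PUMPS from `0` and `2` (weights `1`) AND a forward LEAK from `1` (weight `1`) — so it lies in NEITHER landed
class-wide form (the pump form needs the pocket unfed forward, the leak form needs no in-shell coupling) — and on which `ShellBarrierAt R ε₀ α`
holds for every `R` and EVERY `ε₀ ∈ (0, 1]` (`starvedNetwork_shellBarrierAt`, `Q = {3}`, `r = 4`). [this file] -/
theorem mixedPocket_nonempty_shellBarrierAt : ∃ α : Fin 4 → Fin 4 → Fin 4 → ℤ × ℤ × ℤ → ℝ,
    Literature.Analysis.FluidPDE.TaoCascade.InTableClass 4 α ∧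
    (∀ (Y : Fin 4 → ℤ → ℝ → ℝ) (τ : ℝ), (∀ (j : Fin 4) (k : ℤ), 1 ≤ k → 0 ≤ Y j k τ) →
      ∀ δ : ℝ, 0 < δ → ∀ (i : Fin 4) (n : ℤ), 1 ≤ n → Y i n τ = 0 → 0 ≤ quadTerm δ α Y i n τ) ∧
    (∀ a b i : Fin 4, a ≠ b → α a b i (0, 0, 1) = 0) ∧
    (∀ a : Fin 4, a ≠ 3 → ∃ e : Fin 4, e ≠ 3 ∧ α a a e (0, 0, 1) ≠ 0) ∧
    α 1 1 3 (0, 0, 1) ≠ 0 ∧ α 0 0 3 (0, 0, 0) ≠ 0 ∧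
    ∀ R ε₀ : ℝ, 0 < ε₀ → ε₀ ≤ 1 → ShellBarrierAt R ε₀ α := by
  set α : Fin 4 → Fin 4 → Fin 4 → ℤ × ℤ × ℤ → ℝ := fun i₁ i₂ i₃ μ =>
    if μ = ((0 : ℤ), (0 : ℤ), (1 : ℤ)) then
      ((if i₁ = i₂ ∧ ((i₁ = 0 ∧ i₃ = 1) ∨ (i₁ = 1 ∧ i₃ = 2) ∨ (i₁ = 2 ∧ i₃ = 0)) then (1 / 2 : ℝ) else 0) +
        (if i₁ = i₂ ∧ i₁ = 1 ∧ i₃ = 3 then (1 : ℝ) else 0))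
    else if μ = ((1 : ℤ), (0 : ℤ), (0 : ℤ)) then
      ((if i₂ = i₃ ∧ ((i₂ = 0 ∧ i₁ = 1) ∨ (i₂ = 1 ∧ i₁ = 2) ∨ (i₂ = 2 ∧ i₁ = 0)) then (-(1 / 4) : ℝ) else 0) +
        (if i₂ = i₃ ∧ i₂ = 1 ∧ i₁ = 3 then (-(1 / 2) : ℝ) else 0))
    else if μ = ((0 : ℤ), (1 : ℤ), (0 : ℤ)) then
      ((if i₁ = i₃ ∧ ((i₁ = 0 ∧ i₂ = 1) ∨ (i₁ = 1 ∧ i₂ = 2) ∨ (i₁ = 2 ∧ i₂ = 0)) then (-(1 / 4) : ℝ) else 0) +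
        (if i₁ = i₃ ∧ i₁ = 1 ∧ i₂ = 3 then (-(1 / 2) : ℝ) else 0))
    else if μ = ((0 : ℤ), (0 : ℤ), (0 : ℤ)) then
      ((if i₁ = i₂ ∧ (i₁ = 0 ∨ i₁ = 2) ∧ i₃ = 3 then (1 : ℝ) else 0) +
        (if i₂ = 3 ∧ i₃ = i₁ ∧ (i₁ = 0 ∨ i₁ = 2) then -(1 / 2) else 0) +
        (if i₁ = 3 ∧ i₃ = i₂ ∧ (i₂ = 0 ∨ i₂ = 2) then -(1 / 2) else 0))
    else 0 with hα
  have hfeed : ∀ i₁ i₂ i₃ : Fin 4, α i₁ i₂ i₃ ((0 : ℤ), (0 : ℤ), (1 : ℤ)) =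
      (if i₁ = i₂ ∧ ((i₁ = 0 ∧ i₃ = 1) ∨ (i₁ = 1 ∧ i₃ = 2) ∨ (i₁ = 2 ∧ i₃ = 0)) then (1 / 2 : ℝ) else 0) +
        (if i₁ = i₂ ∧ i₁ = 1 ∧ i₃ = 3 then (1 : ℝ) else 0) := fun _ _ _ => by simp [hα]
  have hup1 : ∀ i₁ i₂ i₃ : Fin 4, α i₁ i₂ i₃ ((1 : ℤ), (0 : ℤ), (0 : ℤ)) =
      (if i₂ = i₃ ∧ ((i₂ = 0 ∧ i₁ = 1) ∨ (i₂ = 1 ∧ i₁ = 2) ∨ (i₂ = 2 ∧ i₁ = 0)) then (-(1 / 4) : ℝ) else 0) +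
        (if i₂ = i₃ ∧ i₂ = 1 ∧ i₁ = 3 then (-(1 / 2) : ℝ) else 0) := fun _ _ _ => by simp [hα]
  have hup2 : ∀ i₁ i₂ i₃ : Fin 4, α i₁ i₂ i₃ ((0 : ℤ), (1 : ℤ), (0 : ℤ)) =
      (if i₁ = i₃ ∧ ((i₁ = 0 ∧ i₂ = 1) ∨ (i₁ = 1 ∧ i₂ = 2) ∨ (i₁ = 2 ∧ i₂ = 0)) then (-(1 / 4) : ℝ) else 0) +
        (if i₁ = i₃ ∧ i₁ = 1 ∧ i₂ = 3 then (-(1 / 2) : ℝ) else 0) := fun _ _ _ => by simp [hα]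
  have hin : ∀ i₁ i₂ i₃ : Fin 4, α i₁ i₂ i₃ ((0 : ℤ), (0 : ℤ), (0 : ℤ)) =
      (if i₁ = i₂ ∧ (i₁ = 0 ∨ i₁ = 2) ∧ i₃ = 3 then (1 : ℝ) else 0) + (if i₂ = 3 ∧ i₃ = i₁ ∧ (i₁ = 0 ∨ i₁ = 2) then -(1 / 2) else 0) +
        (if i₁ = 3 ∧ i₃ = i₂ ∧ (i₂ = 0 ∨ i₂ = 2) then -(1 / 2) else 0) := fun _ _ _ => by simp [hα]
  obtain ⟨⟨hsymm, hcanc⟩, -⟩ := mixedPocket_symmCanc hfeed hup1 hup2 hin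
  obtain ⟨hcomp, -⟩ := mixedPocket_comparable hfeed hup1 hup2 hin
  obtain ⟨horth, -⟩ := mixedPocket_orthant hfeed hup1 hup2 hin
  obtain ⟨hD, hPnn, hCz, hQw, hQP, hPQ, hGram, hlive, hleak, hpump⟩ := mixedPocket_classHyps hfeed hin
  refine ⟨α, ⟨hsymm, hcanc, hcomp⟩, horth, hD, hlive, hleak, hpump, fun R ε₀ hε hε1 => ?_⟩
  exact starvedNetwork_shellBarrierAt (Q := ({3} : Finset (Fin 4))) (P := fun a d => α a a d (0, 0, 0)) (r := 4) hε hPnn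
    (by linarith) hGram hD (fun _ _ => rfl) hCz hQw hQP hPQ R

end Summit.NavierStokesRegularity.NavierStokesRegularity.Theorems

end
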